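import Mathlib
import Summits.ValiantsHypothesis.ValiantsHypothesis.Theorems.ElementaryWordLengthWordLengthQPStubMainAWAsg

/-!
# Crux `WordLengthQP` (stmt-ValiantsHypothesis-6623), line `Sketch` (eps-order-ladder) —
stub `stub_mainAW`, infrastructure file 2 (degeneration, top parts, cuts)

Infrastructure for the Allender–Wang cutting/finishing argument (Allender–Wang 2016,
ECCC TR11-083, §3.3 Lemma 26, Obs. 29/33, Thm 34; §4.1 Thm 38) in the S-affine width-2 model:
existence of degenerating assignments of `≤ 4` variables for an S-affine matrix with non-unit
determinant (root lemma over `ℂ`: restrict to a line and use algebraic closedness),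
multiplicativity of top homogeneous parts and the key factoring step for robust polynomials,
list-splitting bookkeeping (last violator, minimal prefix, splits of mapped lists), and
inheritance of bad cuts under assignments (AW16 Obs. 33).
-/

-- `Summit.ValiantsHypothesis.ValiantsHypothesis.…` is the tree's mandated single-conjunct layout
-- (Sub = Summit), so the duplicated namespace component is intended.
set_option linter.dupNamespace false

noncomputable section

open MvPolynomial

namespace Summit.ValiantsHypothesis.ValiantsHypothesis.Cruxes.WordLengthQP.EpsOrderLadder

/-! ### (I5) Degenerating assignments -/

/-- **Root lemma**: a non-constant polynomial over `ℂ` has a zero (restrict to a line through two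
points with different values and use algebraic closedness). [folklore] -/
theorem mainAW_exists_root {σ : Type*} (p : MvPolynomial σ ℂ) (hp : ∀ c : ℂ, p ≠ C c) :
    ∃ x : σ → ℂ, eval x p = 0 := by
  -- two points with different values
  have hne : ∃ x y : σ → ℂ, eval x p ≠ eval y p := by
    by_contra h
    push Not at h
    refine hp (eval (fun _ => 0) p) (MvPolynomial.funext fun x => ?_)
    rw [eval_C]
    exact h x _
  obtain ⟨x, y, hxy⟩ := hne
  -- restrict to the line through `x` and `y`
  have hline : ∀ t : ℂ,
      (aeval (fun v => Polynomial.C (x v) + Polynomial.X * Polynomial.C (y v - x v)) p :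
        Polynomial ℂ).eval t = eval (fun v => x v + t * (y v - x v)) p := by
    intro t
    have key : (Polynomial.evalRingHom t).comp
        (aeval (fun v => Polynomial.C (x v) + Polynomial.X * Polynomial.C (y v - x v)) :
          MvPolynomial σ ℂ →ₐ[ℂ] Polynomial ℂ).toRingHom =
        eval (fun v => x v + t * (y v - x v)) := by
      refine ringHom_ext (fun r => ?_) (fun i => ?_)
      · simp
      · simp
    exact RingHom.congr_fun key p
  set q : Polynomial ℂ :=
    aeval (fun v => Polynomial.C (x v) + Polynomial.X * Polynomial.C (y v - x v)) p with hq
  have h0 : q.eval 0 = eval x p := by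
    rw [hq, hline]
    simp
  have h1 : q.eval 1 = eval y p := by
    rw [hq, hline]
    have : (fun v => x v + (1 : ℂ) * (y v - x v)) = y := funext fun v => by ring
    rw [this]
  have hdeg : q.degree ≠ 0 := by
    intro hd
    apply hxy
    rw [← h0, ← h1, Polynomial.eq_C_of_degree_eq_zero hd, Polynomial.eval_C, Polynomial.eval_C]
  obtain ⟨t₀, ht₀⟩ := IsAlgClosed.exists_root q hdeg
  exact ⟨fun v => x v + t₀ * (y v - x v), by rw [← hline]; exact ht₀⟩

/-- The `≤ 4` variables of an S-affine `2 × 2` matrix. [folklore] -/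
theorem mainAW_vars4 {σ : Type*} [DecidableEq σ] (m : Matrix (Fin 2) (Fin 2) (MvPolynomial σ ℂ))
    (hm : ∀ i j : Fin 2, (∃ b : ℂ, m i j = C b) ∨
      (∃ (a b : ℂ) (v : σ), m i j = C a * X v + C b)) :
    ∃ V : Finset σ, V.card ≤ 4 ∧ ∀ i j : Fin 2, (∃ b : ℂ, m i j = C b) ∨
      (∃ (a b : ℂ) (v : σ), v ∈ V ∧ m i j = C a * X v + C b) := by
  have h1 : ∀ i j : Fin 2, ∃ S : Finset σ, S.card ≤ 1 ∧ ((∃ b : ℂ, m i j = C b) ∨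
      (∃ (a b : ℂ) (v : σ), v ∈ S ∧ m i j = C a * X v + C b)) := by
    intro i j
    rcases hm i j with ⟨b, hb⟩ | ⟨a, b, v, hab⟩
    · exact ⟨∅, by simp, Or.inl ⟨b, hb⟩⟩
    · exact ⟨{v}, by simp, Or.inr ⟨a, b, v, Finset.mem_singleton_self v, hab⟩⟩
  choose S hS hS' using h1
  refine ⟨S 0 0 ∪ S 0 1 ∪ (S 1 0 ∪ S 1 1), ?_, fun i j => ?_⟩
  · calc (S 0 0 ∪ S 0 1 ∪ (S 1 0 ∪ S 1 1)).card
          ≤ (S 0 0 ∪ S 0 1).card + (S 1 0 ∪ S 1 1).card := Finset.card_union_le _ _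
      _ ≤ ((S 0 0).card + (S 0 1).card) + ((S 1 0).card + (S 1 1).card) :=
          add_le_add (Finset.card_union_le _ _) (Finset.card_union_le _ _)
      _ ≤ (1 + 1) + (1 + 1) :=
          add_le_add (add_le_add (hS 0 0) (hS 0 1)) (add_le_add (hS 1 0) (hS 1 1))
  · have hsub : ∀ i j : Fin 2, S i j ⊆ S 0 0 ∪ S 0 1 ∪ (S 1 0 ∪ S 1 1) := by
      intro i j
      fin_cases i <;> fin_cases j
      · exact Finset.subset_union_left.trans Finset.subset_union_left
      · exact Finset.subset_union_right.trans Finset.subset_union_left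
      · exact Finset.subset_union_left.trans Finset.subset_union_right
      · exact Finset.subset_union_right.trans Finset.subset_union_right
    rcases hS' i j with h | ⟨a, b, v, hv, hab⟩
    · exact Or.inl h
    · exact Or.inr ⟨a, b, v, hsub i j hv, hab⟩

/-- If an assignment with values `a` makes all entries of `m` constant, it maps `det m` to the
constant `det m (a)`. [folklore] -/
theorem mainAW_asg_det {σ : Type*} [DecidableEq σ] (Z : Finset σ) (a : σ → ℂ)
    (m : Matrix (Fin 2) (Fin 2) (MvPolynomial σ ℂ))
    (h : ∀ i j : Fin 2, ∃ c : ℂ,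
      aeval (fun w : σ => if w ∈ Z then C (a w) else (X w : MvPolynomial σ ℂ)) (m i j) = C c) :
    aeval (fun w : σ => if w ∈ Z then C (a w) else (X w : MvPolynomial σ ℂ)) m.det =
      C (eval a m.det) := by
  obtain ⟨N, hN⟩ := mainAW_constMat _ m h
  have h1 : aeval (fun w : σ => if w ∈ Z then C (a w) else (X w : MvPolynomial σ ℂ)) m.det =
      C N.det := by
    rw [← mainAW_det_map, hN, ← RingHom.mapMatrix_apply, ← RingHom.map_det]
  have h2 := mainAW_eval_asg Z a m.det
  rw [h1, eval_C] at h2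
  rw [h1, h2]

/-- **Degenerating assignments** (AW16 Lemma 24/40, S-model): a matrix with S-affine entries whose
determinant is not a non-zero constant becomes a constant singular matrix after assigning
suitable values to its `≤ 4` variables. [folklore] -/
theorem mainAW_degen {σ : Type} [DecidableEq σ] (m : Matrix (Fin 2) (Fin 2) (MvPolynomial σ ℂ))
    (hm : ∀ i j : Fin 2, (∃ b : ℂ, m i j = MvPolynomial.C b) ∨
      (∃ (a b : ℂ) (v : σ), m i j = MvPolynomial.C a * MvPolynomial.X v + MvPolynomial.C b))
    (hindg : ¬ ∃ d : ℂ, d ≠ 0 ∧ m.det = MvPolynomial.C d) :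
    ∃ (Z : Finset σ) (a : σ → ℂ), Z.card ≤ 4 ∧
      (∀ i j : Fin 2, ∃ c : ℂ,
        MvPolynomial.aeval (fun w : σ => if w ∈ Z then MvPolynomial.C (a w)
          else (MvPolynomial.X w : MvPolynomial σ ℂ)) (m i j) = MvPolynomial.C c) ∧
      MvPolynomial.aeval (fun w : σ => if w ∈ Z then MvPolynomial.C (a w)
        else (MvPolynomial.X w : MvPolynomial σ ℂ)) m.det = 0 := by
  obtain ⟨V, hV, hmV⟩ := mainAW_vars4 m hm
  have hconst : ∀ a : σ → ℂ, ∀ i j : Fin 2, ∃ c : ℂ,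
      aeval (fun w : σ => if w ∈ V then C (a w) else (X w : MvPolynomial σ ℂ)) (m i j) = C c :=
    fun a => mainAW_asg_const V V a m hmV subset_rfl
  have hroot : ∃ a : σ → ℂ, eval a m.det = 0 := by
    by_cases hc : ∃ c : ℂ, m.det = C c
    · obtain ⟨c, hc⟩ := hc
      have h0 : c = 0 := by
        by_contra hne
        exact hindg ⟨c, hne, hc⟩
      exact ⟨fun _ => 0, by rw [hc, eval_C, h0]⟩
    · push Not at hc
      exact mainAW_exists_root m.det hc
  obtain ⟨a, ha⟩ := hroot
  exact ⟨V, a, hV, hconst a, by rw [mainAW_asg_det V a m (hconst a), ha, C_0]⟩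

/-! ### (I6) Top homogeneous parts multiply -/

/-- The top homogeneous part of a product is the product of the top parts (no zero-divisor
hypothesis needed at the level of components). [folklore] -/
theorem mainAW_top_mul {σ : Type*} {R : Type*} [CommSemiring R] (g h : MvPolynomial σ R) :
    homogeneousComponent (g.totalDegree + h.totalDegree) (g * h) =
      homogeneousComponent g.totalDegree g * homogeneousComponent h.totalDegree h := by
  classical
  ext d
  rw [coeff_homogeneousComponent, coeff_mul, coeff_mul]
  simp_rw [coeff_homogeneousComponent]
  split_ifs with hd
  · refine Finset.sum_congr rfl ?_
    rintro ⟨d₁, d₂⟩ hmem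
    rw [Finset.HasAntidiagonal.mem_antidiagonal] at hmem
    have hdeg : d₁.degree + d₂.degree = g.totalDegree + h.totalDegree := by
      rw [← map_add, hmem, hd]
    dsimp only
    by_cases h₁ : d₁.degree = g.totalDegree
    · have h₂ : d₂.degree = h.totalDegree := by omega
      rw [if_pos h₁, if_pos h₂]
    · rw [if_neg h₁, zero_mul]
      rcases lt_or_gt_of_ne h₁ with hlt | hgt
      · have : h.totalDegree < d₂.degree := by omega
        rw [coeff_eq_zero_of_totalDegree_lt this, mul_zero]
      · rw [coeff_eq_zero_of_totalDegree_lt hgt, zero_mul]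
  · symm
    refine Finset.sum_eq_zero ?_
    rintro ⟨d₁, d₂⟩ hmem
    rw [Finset.HasAntidiagonal.mem_antidiagonal] at hmem
    dsimp only
    split_ifs with h₁ h₂
    · exfalso
      apply hd
      rw [← hmem, map_add, h₁, h₂]
    all_goals simp

/-- The top homogeneous part of a non-zero polynomial is non-zero. [folklore] -/
theorem mainAW_top_ne_zero {σ : Type*} {R : Type*} [CommSemiring R] (p : MvPolynomial σ R)
    (hp : p ≠ 0) : homogeneousComponent p.totalDegree p ≠ 0 := by
  obtain ⟨e, he, hedeg⟩ := Finset.exists_mem_eq_sup p.support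
    (Finset.nonempty_of_ne_empty (by rwa [Ne, support_eq_empty])) (fun s => s.sum fun _ n => n)
  intro h0
  have := congrArg (coeff e) h0
  rw [coeff_homogeneousComponent, coeff_zero, if_pos] at this
  · exact (mem_support_iff.1 he) this
  · rw [totalDegree, hedeg, Finsupp.degree_apply]
    rfl

/-- **Key factoring step**: a polynomial of degree `≥ 2` whose top part is not a product of two
positive-degree polynomials has only trivial factorisations. [folklore] -/
theorem mainAW_key_factor {σ : Type*} (p g h : MvPolynomial σ ℂ) (h2 : 2 ≤ p.totalDegree)
    (hnf : ¬ ∃ g' h' : MvPolynomial σ ℂ, 0 < g'.totalDegree ∧ 0 < h'.totalDegree ∧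
      homogeneousComponent p.totalDegree p = g' * h')
    (hp : p = g * h) : g.totalDegree = 0 ∨ h.totalDegree = 0 := by
  by_contra hcon
  push Not at hcon
  have hg0 : g ≠ 0 := by
    rintro rfl
    rw [zero_mul] at hp
    rw [hp, totalDegree_zero] at h2
    omega
  have hh0 : h ≠ 0 := by
    rintro rfl
    rw [mul_zero] at hp
    rw [hp, totalDegree_zero] at h2
    omega
  refine hnf ⟨homogeneousComponent g.totalDegree g, homogeneousComponent h.totalDegree h,
    ?_, ?_, ?_⟩
  · rw [(homogeneousComponent_isHomogeneous _ _).totalDegree (mainAW_top_ne_zero g hg0)]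
    exact Nat.pos_of_ne_zero hcon.1
  · rw [(homogeneousComponent_isHomogeneous _ _).totalDegree (mainAW_top_ne_zero h hh0)]
    exact Nat.pos_of_ne_zero hcon.2
  · rw [hp, totalDegree_mul_of_isDomain hg0 hh0, mainAW_top_mul]

/-! ### (I7) List splitting -/

/-- Either every member satisfies `P`, or there is a LAST member violating `P`. [folklore] -/
theorem mainAW_split_last {α : Type*} (P : α → Prop) (l : List α) :
    (∀ x ∈ l, P x) ∨ ∃ (pre : List α) (x : α) (suf : List α),
      l = pre ++ x :: suf ∧ ¬ P x ∧ ∀ y ∈ suf, P y := by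
  induction l with
  | nil => exact Or.inl (by simp)
  | cons x l ih =>
    rcases ih with hall | ⟨pre, y, suf, hl, hy, hsuf⟩
    · by_cases hx : P x
      · exact Or.inl (List.forall_mem_cons.2 ⟨hx, hall⟩)
      · exact Or.inr ⟨[], x, l, rfl, hx, hall⟩
    · exact Or.inr ⟨x :: pre, y, suf, by rw [hl]; rfl, hy, hsuf⟩

/-- A split `l = pre ++ x :: suf` with `Q pre x` can be chosen with `pre` minimal: no split of
`pre` itself satisfies `Q`. [folklore] -/
theorem mainAW_split_min {α : Type*} (Q : List α → α → Prop) (l : List α)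
    (h : ∃ (pre : List α) (x : α) (suf : List α), l = pre ++ x :: suf ∧ Q pre x) :
    ∃ (pre : List α) (x : α) (suf : List α), l = pre ++ x :: suf ∧ Q pre x ∧
      ∀ (pre' : List α) (x' : α) (suf' : List α), pre = pre' ++ x' :: suf' → ¬ Q pre' x' := by
  classical
  have hex : ∃ k, ∃ (pre : List α) (x : α) (suf : List α),
      l = pre ++ x :: suf ∧ Q pre x ∧ pre.length = k := by
    obtain ⟨pre, x, suf, hl, hQ⟩ := h
    exact ⟨pre.length, pre, x, suf, hl, hQ, rfl⟩
  obtain ⟨pre, x, suf, hl, hQ, hlen⟩ := Nat.find_spec hex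
  refine ⟨pre, x, suf, hl, hQ, fun pre' x' suf' hpre hQ' => ?_⟩
  have hlt : pre'.length < Nat.find hex := by
    rw [← hlen, hpre, List.length_append, List.length_cons]
    omega
  exact Nat.find_min hex hlt ⟨pre', x', suf' ++ x :: suf, by rw [hl, hpre]; simp, hQ', rfl⟩

/-- Splits of a mapped list come from splits of the list. [folklore] -/
theorem mainAW_map_split {α β : Type*} (f : α → β) (l : List α) (P₁ : List β) (M : β)
    (P₂ : List β) (h : l.map f = P₁ ++ M :: P₂) :
    ∃ (pre : List α) (x : α) (suf : List α),
      l = pre ++ x :: suf ∧ pre.map f = P₁ ∧ f x = M ∧ suf.map f = P₂ := by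
  obtain ⟨l₁, l₂, rfl, h₁, h₂⟩ := List.map_eq_append_iff.1 h
  obtain ⟨x, suf, rfl, hx, hsuf⟩ := List.map_eq_cons_iff.1 h₂
  exact ⟨l₁, x, suf, rfl, h₁, hx, hsuf⟩

/-! ### (I8) `Bad` is inherited by assigned prefixes (AW16 Obs. 33) -/

/-- `Bad A pre m` — "whenever an assignment makes `m` a constant singular matrix, the register
row after `m` is constant" — is inherited by the assigned program `(pre.map φ₁, m.map φ₁)`,
because assignments compose to assignments. [folklore] -/
theorem mainAW_bad_map {σ : Type} [DecidableEq σ] (A : Matrix (Fin 2) (Fin 2) ℂ)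
    (pre : List (Matrix (Fin 2) (Fin 2) (MvPolynomial σ ℂ)))
    (m : Matrix (Fin 2) (Fin 2) (MvPolynomial σ ℂ)) (Z₁ : Finset σ) (a₁ : σ → ℂ)
    (hbad : ∀ (Z : Finset σ) (a : σ → ℂ),
      (∀ i j : Fin 2, ∃ c : ℂ, MvPolynomial.aeval (fun w : σ => if w ∈ Z then MvPolynomial.C (a w)
        else (MvPolynomial.X w : MvPolynomial σ ℂ)) (m i j) = MvPolynomial.C c) →
      MvPolynomial.aeval (fun w : σ => if w ∈ Z then MvPolynomial.C (a w)
        else (MvPolynomial.X w : MvPolynomial σ ℂ)) m.det = 0 →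
      ∀ j : Fin 2, ∃ κ : ℂ,
        ((A.map (MvPolynomial.C (σ := σ) (R := ℂ))) *
          (pre.map (fun m' => m'.map (MvPolynomial.aeval (fun w : σ => if w ∈ Z then
            MvPolynomial.C (a w) else (MvPolynomial.X w : MvPolynomial σ ℂ))))).prod *
          m.map (MvPolynomial.aeval (fun w : σ => if w ∈ Z then MvPolynomial.C (a w)
            else (MvPolynomial.X w : MvPolynomial σ ℂ)))) 0 j = MvPolynomial.C κ) :
    ∀ (Z : Finset σ) (a : σ → ℂ),
      (∀ i j : Fin 2, ∃ c : ℂ,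
        MvPolynomial.aeval (fun w : σ => if w ∈ Z then MvPolynomial.C (a w)
          else (MvPolynomial.X w : MvPolynomial σ ℂ))
          ((m.map (MvPolynomial.aeval (fun w : σ => if w ∈ Z₁ then MvPolynomial.C (a₁ w)
            else (MvPolynomial.X w : MvPolynomial σ ℂ)))) i j) = MvPolynomial.C c) →
      MvPolynomial.aeval (fun w : σ => if w ∈ Z then MvPolynomial.C (a w)
        else (MvPolynomial.X w : MvPolynomial σ ℂ))
        (m.map (MvPolynomial.aeval (fun w : σ => if w ∈ Z₁ then MvPolynomial.C (a₁ w)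
          else (MvPolynomial.X w : MvPolynomial σ ℂ)))).det = 0 →
      ∀ j : Fin 2, ∃ κ : ℂ,
        ((A.map (MvPolynomial.C (σ := σ) (R := ℂ))) *
          ((pre.map (fun m' => m'.map (MvPolynomial.aeval (fun w : σ => if w ∈ Z₁ then
            MvPolynomial.C (a₁ w) else (MvPolynomial.X w : MvPolynomial σ ℂ))))).map
            (fun m' => m'.map (MvPolynomial.aeval (fun w : σ => if w ∈ Z then
              MvPolynomial.C (a w) else (MvPolynomial.X w : MvPolynomial σ ℂ))))).prod *
          (m.map (MvPolynomial.aeval (fun w : σ => if w ∈ Z₁ then MvPolynomial.C (a₁ w)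
            else (MvPolynomial.X w : MvPolynomial σ ℂ)))).map
            (MvPolynomial.aeval (fun w : σ => if w ∈ Z then MvPolynomial.C (a w)
              else (MvPolynomial.X w : MvPolynomial σ ℂ)))) 0 j = MvPolynomial.C κ := by
  intro Z a hc hdet j
  have hcomp := mainAW_asg_comp Z₁ Z a₁ a
  have hmm : ∀ m₀ : Matrix (Fin 2) (Fin 2) (MvPolynomial σ ℂ),
      (m₀.map (aeval (fun w : σ => if w ∈ Z₁ then C (a₁ w) else (X w : MvPolynomial σ ℂ)))).map
        (aeval (fun w : σ => if w ∈ Z then C (a w) else (X w : MvPolynomial σ ℂ))) =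
      m₀.map (aeval (fun w : σ => if w ∈ Z₁ ∪ Z then C (if w ∈ Z₁ then a₁ w else a w)
        else (X w : MvPolynomial σ ℂ))) := by
    intro m₀
    ext i k : 1
    rw [Matrix.map_apply, Matrix.map_apply, Matrix.map_apply, hcomp]
  have hpre : (pre.map (fun m' => m'.map
      (aeval (fun w : σ => if w ∈ Z₁ then C (a₁ w) else (X w : MvPolynomial σ ℂ))))).map
      (fun m' => m'.map (aeval (fun w : σ => if w ∈ Z then C (a w) else (X w : MvPolynomial σ ℂ))))
      = pre.map (fun m' => m'.map (aeval (fun w : σ => if w ∈ Z₁ ∪ Z then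
          C (if w ∈ Z₁ then a₁ w else a w) else (X w : MvPolynomial σ ℂ)))) := by
    rw [List.map_map]
    exact List.map_congr_left fun m₀ _ => hmm m₀
  have hc' : ∀ i k : Fin 2, ∃ c : ℂ, aeval (fun w : σ => if w ∈ Z₁ ∪ Z then
      C (if w ∈ Z₁ then a₁ w else a w) else (X w : MvPolynomial σ ℂ)) (m i k) = C c := by
    intro i k
    obtain ⟨c, hck⟩ := hc i k
    rw [Matrix.map_apply, hcomp] at hck
    exact ⟨c, hck⟩
  have hdet' : aeval (fun w : σ => if w ∈ Z₁ ∪ Z then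
      C (if w ∈ Z₁ then a₁ w else a w) else (X w : MvPolynomial σ ℂ)) m.det = 0 := by
    rw [mainAW_det_map, hcomp] at hdet
    exact hdet
  obtain ⟨κ, hκ⟩ := hbad (Z₁ ∪ Z) (fun w => if w ∈ Z₁ then a₁ w else a w) hc' hdet' j
  refine ⟨κ, ?_⟩
  rw [hpre, hmm]
  exact hκ

end Summit.ValiantsHypothesis.ValiantsHypothesis.Cruxes.WordLengthQP.EpsOrderLadder

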